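import Literature.Topology.FourManifolds.DiscIsotopyExtension
import Literature.Topology.FourManifolds.BlendCollars
import HarnessLib

/-!
# Collar normalisation of a germ of the closed ball fixing the boundary sphere pointwise
# (fourth step of: `Diff⁺(D²)` is connected, in ambient-germ form)

Topic `Literature/Topology/FourManifolds` (programme of the fact
`Literature.Topology.FourManifolds.cerf_pi0DiffDisc_relBoundary_three`, brick C3a).  Let `f` be an embedding germ of the closed unit ball
`𝔻` onto itself fixing the unit sphere pointwise (for the disc:
`DiscIsotopyExtension.exists_factor_fixing_sphere`).  We show that `f` is related, through a
self-isotopy of `𝔻` (`PiecePar.IsoRel`), to a germ `f₂` which is THE IDENTITY ON A COLLAR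
`{1 - δ < ‖x‖ ≤ 1}` of the sphere (`exists_isoRel_eq_id_near_sphere`).

The isotopy is the **splice family** `D_v x = x + σ(v) ω_L(1 - ‖x‖) • (f x - x)` — for each
`v` the log-slow splice (`CollarUniquenessBall.splice`, Hirsch's uniqueness of collars in the
tree's elementary ambient form) of the blend `θ_s = id + s (f - id)`, `s = σ(v) ∈ [0, 1]`
(`σ = Real.smoothTransition`), with the identity: `D₀ = id`, and `D₁` agrees with `f` on the
collar `{1 - e^{-2L} ≤ ‖x‖}` and with the identity inside radius `1 - e^{-L}`.  Every blend
`θ_s` is again an inner collar with the SAME splice constants (`isInnerCollar_blend`,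
`spliceHyp_blend`: blends of blends are blends, `‖θ_s x - x‖ ≤ ‖f x - x‖`), so the tree's
splice theorems (`SpliceHyp.injOn_splice`, `surjOn_splice`, `exists_hasStrictFDerivAt`) make
every stage an embedding germ of `𝔻` onto itself (`isSelfIsotopy_spliceFamily`); hence
`f₂ := f ∘ D₁⁻¹` is in the class of `f` and is the identity near the sphere.  The construction
only uses `f` on a shell: for any inner collar `f` of width `ε` (`IsInnerCollar ε f g`, `f`
smooth) the splice family is a self-isotopy of the ball from the identity whose end agrees with
`f` on a collar of the sphere (`exists_selfIsotopy_of_innerCollar` — realising a collar germ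
by an isotopically trivial germ of the ball).

## References
* [HirschDT1976] M. W. Hirsch, *Differential Topology*, GTM 33 (1976), Ch. 4 §6 and Ch. 8,
  Thm. 1.8 with the remark following it (uniqueness of collars: the germ of an isotopy of collars
  extends to a diffeotopy).
* [CerfDiffeoSphere1968] J. Cerf, LNM 53 (1968), Ch. IV §3, Propriété 3.
-/

noncomputable section

open Set Function Filter Topology Metric Real
open scoped ContDiff

namespace Literature.Topology.FourManifolds

namespace CollarNormalisation

variable {E : Type*} [NormedAddCommGroup E] [InnerProductSpace ℝ E]

/-! ### The two-sided smooth log-slow cutoff -/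

/-- The cutoff `ω_L`: equal to `1` for `t ≤ e^{-2L}` (in particular for `t ≤ 0`) and to the
tree's `logCutoff L t` for `t > 0`. [folklore] -/
def omegaCut (L t : ℝ) : ℝ := if t ≤ exp (-2 * L) then 1 else logCutoff L t

variable {L : ℝ}

/-- For `t > 0` the cutoff is the log-slow cutoff. [folklore] -/
theorem omegaCut_eq_logCutoff (hL : 0 < L) {t : ℝ} (ht : 0 < t) : omegaCut L t = logCutoff L t := by
  unfold omegaCut
  split_ifs with h
  · exact (logCutoff_eq_one hL ht h).symm
  · rfl

/-- `ω_L t = 1` for `t ≤ e^{-2L}`. [folklore] -/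
theorem omegaCut_eq_one {t : ℝ} (ht : t ≤ exp (-2 * L)) : omegaCut L t = 1 := by
  unfold omegaCut; rw [if_pos ht]

/-- `ω_L t = 0` for `e^{-L} ≤ t`. [folklore] -/
theorem omegaCut_eq_zero (hL : 0 < L) {t : ℝ} (ht : exp (-L) ≤ t) : omegaCut L t = 0 := by
  have hpos : 0 < t := (exp_pos _).trans_le ht
  rw [omegaCut_eq_logCutoff hL hpos, logCutoff_eq_zero hL ht]

/-- `ω_L ∈ [0, 1]`. [folklore] -/
theorem omegaCut_mem_Icc (L t : ℝ) : omegaCut L t ∈ Icc (0 : ℝ) 1 := by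
  unfold omegaCut; split_ifs
  · exact ⟨zero_le_one, le_rfl⟩
  · exact logCutoff_mem_Icc L t

/-- The cutoff is smooth. [folklore] -/
theorem contDiff_omegaCut (hL : 0 < L) : ContDiff ℝ ∞ (omegaCut L) := by
  refine contDiff_iff_contDiffAt.2 fun t => ?_
  by_cases ht : t < exp (-2 * L)
  · -- locally constant `1`
    have hev : omegaCut L =ᶠ[𝓝 t] fun _ => (1 : ℝ) := by
      filter_upwards [Iio_mem_nhds ht] with u hu
      exact omegaCut_eq_one hu.le
    exact (contDiffAt_const.congr_of_eventuallyEq hev)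
  · -- `t > 0`: locally the log-slow cutoff
    have htpos : 0 < t := (exp_pos _).trans_le (not_lt.1 ht)
    have hev : omegaCut L =ᶠ[𝓝 t] logCutoff L := by
      filter_upwards [Ioi_mem_nhds htpos] with u hu
      exact omegaCut_eq_logCutoff hL hu
    exact (contDiffAt_logCutoff htpos.ne').congr_of_eventuallyEq hev

/-- `x ↦ ω_L (1 - ‖x‖)` is smooth on the whole space (it vanishes near the origin). [folklore] -/
theorem contDiff_omegaCut_depth (hL : 0 < L) : ContDiff ℝ ∞ fun x : E => omegaCut L (1 - ‖x‖) := by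
  refine contDiff_iff_contDiffAt.2 fun x => ?_
  by_cases hx : ‖x‖ < 1 - exp (-L)
  · have hev : (fun y : E => omegaCut L (1 - ‖y‖)) =ᶠ[𝓝 x] fun _ => (0 : ℝ) := by
      filter_upwards [(isOpen_lt continuous_norm continuous_const).mem_nhds hx] with y hy
      exact omegaCut_eq_zero hL (by linarith)
    exact contDiffAt_const.congr_of_eventuallyEq hev
  · have hx0 : x ≠ 0 := by
      intro h0; rw [h0, norm_zero] at hx
      exact hx (by linarith [exp_lt_one_iff.2 (show -L < 0 by linarith)])
    exact (contDiff_omegaCut hL).contDiffAt.comp x (contDiffAt_const.sub (contDiffAt_norm ℝ hx0))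

/-! ### Blends and the splice family -/

/-- The blend `θ_s = id + s (f - id)`. [folklore] -/
def blend (f : E → E) (s : ℝ) (x : E) : E := x + s • (f x - x)

/-- `blend_apply` (blend apply). [folklore] -/
theorem blend_apply (f : E → E) (s : ℝ) (x : E) : blend f s x = x + s • (f x - x) := rfl

/-- Blends of blends are blends: `x + t (θ_s x - x) = x + (t s) (f x - x)`. [folklore] -/
theorem blend_blend (f : E → E) (s t : ℝ) (x : E) :
    x + t • (blend f s x - x) = x + (t * s) • (f x - x) := by
  rw [blend_apply, add_sub_cancel_left, smul_smul]

/-- `blend_zero` (blend zero). [folklore] -/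
theorem blend_zero (f : E → E) : blend f 0 = id := by
  funext x; simp [blend]

/-- `blend_one` (blend one). [folklore] -/
theorem blend_one (f : E → E) : blend f 1 = f := by
  funext x; simp [blend]

/-- `blend_sub_self` (blend sub self). [folklore] -/
theorem blend_sub_self (f : E → E) (s : ℝ) (x : E) : blend f s x - x = s • (f x - x) := by
  rw [blend_apply, add_sub_cancel_left]

/-- `contDiff_blend` (contDiff blend). [folklore] -/
theorem contDiff_blend {f : E → E} (hf : ContDiff ℝ ∞ f) (s : ℝ) : ContDiff ℝ ∞ (blend f s) :=
  contDiff_id.add (contDiff_const.smul (hf.sub contDiff_id))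

/-- **The splice family** `D_v x = x + σ(v) ω_L (1 - ‖x‖) • (f x - x)`. [cite: HirschDT1976, Ch. 8, Thm. 1.8] -/
def spliceFamily (f : E → E) (L : ℝ) (v : ℝ) (x : E) : E :=
  x + (smoothTransition v * omegaCut L (1 - ‖x‖)) • (f x - x)

/-- `spliceFamily_apply` (spliceFamily apply). [folklore] -/
theorem spliceFamily_apply (f : E → E) (L v : ℝ) (x : E) :
    spliceFamily f L v x = x + (smoothTransition v * omegaCut L (1 - ‖x‖)) • (f x - x) := rfl

/-- Inside the open ball the stage `D_v` is the tree's splice of the blend `θ_{σ(v)}`.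
[folklore] -/
theorem spliceFamily_eq_splice (hL : 0 < L) (f : E → E) (v : ℝ) {x : E} (hx : ‖x‖ < 1) :
    spliceFamily f L v x = IsInnerCollar.splice (blend f (smoothTransition v)) L x := by
  rw [spliceFamily_apply, IsInnerCollar.splice_apply, blend_sub_self, smul_smul,
    omegaCut_eq_logCutoff hL (by linarith), mul_comm]

/-- Near and beyond the sphere (`1 - e^{-2L} ≤ ‖x‖`) the stage `D_v` is the blend `θ_{σ(v)}`.
[folklore] -/
theorem spliceFamily_eq_blend (f : E → E) (v : ℝ) {x : E} (hx : 1 - exp (-2 * L) ≤ ‖x‖) :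
    spliceFamily f L v x = blend f (smoothTransition v) x := by
  rw [spliceFamily_apply, blend_apply, omegaCut_eq_one (by linarith), mul_one]

/-- `D₀ = id`. [folklore] -/
theorem spliceFamily_zero (f : E → E) (L : ℝ) : spliceFamily f L 0 = id := by
  funext x
  rw [spliceFamily_apply, smoothTransition.zero, zero_mul, zero_smul, add_zero, id]

/-- `D_v` fixes the fixed points of `f` (in particular the unit sphere). [folklore] -/
theorem spliceFamily_of_fixed (L v : ℝ) {f : E → E} {x : E} (hx : f x = x) :
    spliceFamily f L v x = x := by
  rw [spliceFamily_apply, hx, sub_self, smul_zero, add_zero]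

/-- **Joint smoothness of the splice family.** [folklore] -/
theorem contDiff_spliceFamily (hL : 0 < L) {f : E → E} (hf : ContDiff ℝ ∞ f) :
    ContDiff ℝ ∞ (uncurry (spliceFamily f L)) := by
  have h1 : ContDiff ℝ ∞ fun q : ℝ × E => smoothTransition q.1 * omegaCut L (1 - ‖q.2‖) :=
    (smoothTransition.contDiff.comp contDiff_fst).mul ((contDiff_omegaCut_depth hL).comp contDiff_snd)
  have h2 : ContDiff ℝ ∞ fun q : ℝ × E => f q.2 - q.2 := (hf.comp contDiff_snd).sub contDiff_snd
  exact contDiff_snd.add (h1.smul h2)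

/-- The stages are smooth. [folklore] -/
theorem contDiff_spliceFamily_stage (hL : 0 < L) {f : E → E} (hf : ContDiff ℝ ∞ f) (v : ℝ) :
    ContDiff ℝ ∞ (spliceFamily f L v) :=
  (contDiff_spliceFamily hL hf).comp (contDiff_const.prodMk contDiff_id)

/-! ### The germ as an inner collar; blends are inner collars with the same constants -/

section Germ

variable {f : E → E}

/-- A germ of the closed unit ball onto itself fixing the sphere pointwise maps the open ball
into itself. [folklore] -/
theorem norm_lt_one_of_germ (hf : IsEmbGerm (closedBall (0 : E) 1) f)
    (himg : f '' closedBall (0 : E) 1 = closedBall 0 1) (hfix : ∀ x : E, ‖x‖ = 1 → f x = x)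
    {x : E} (hx : ‖x‖ < 1) : ‖f x‖ < 1 := by
  have hxD : x ∈ closedBall (0 : E) 1 := mem_closedBall_zero_iff.2 hx.le
  have h1 : ‖f x‖ ≤ 1 := mem_closedBall_zero_iff.1 (himg ▸ mem_image_of_mem f hxD)
  rcases h1.lt_or_eq with h | h
  · exact h
  · exfalso
    -- `f x` lies on the sphere, where `f` is the identity: `f (f x) = f x`, contradicting injectivity
    have hfx : f (f x) = f x := hfix _ h
    have hmem : f x ∈ closedBall (0 : E) 1 := mem_closedBall_zero_iff.2 h1
    have := hf.injOn hmem hxD hfx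
    rw [this] at h
    exact (lt_irrefl _) (h ▸ hx)

/-- **The germ is an inner collar** of width `1` (left inverse from `IsEmbGerm.exists_inverse`).
[cite: HirschDT1976, §4.6] -/
theorem exists_isInnerCollar [FiniteDimensional ℝ E] (hf : IsEmbGerm (closedBall (0 : E) 1) f)
    (himg : f '' closedBall (0 : E) 1 = closedBall 0 1) (hfix : ∀ x : E, ‖x‖ = 1 → f x = x) :
    ∃ g : E → E, IsInnerCollar 1 f g := by
  obtain ⟨g, hg, hleft, -, -⟩ := hf.exists_inverse (isCompact_closedBall 0 1)
  refine ⟨g, { pos := one_pos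
               contDiffOn := hf.contDiff.contDiffOn
               contDiffOn_symm := hg.contDiffOn
               eq_self := hfix
               norm_le_one := fun x hx => ?_
               norm_lt_one := fun x _ hx1 => norm_lt_one_of_germ hf himg hfix hx1
               left_inv := fun x hx _ => ?_ }⟩
  · exact mem_closedBall_zero_iff.1 (himg ▸ mem_image_of_mem f (closedShell_subset_closedBall hx))
  · exact (hleft.filter_mono (nhds_le_nhdsSet (closedShell_subset_closedBall hx))).self_of_nhds

end Germ


/-! ### Derivatives of blends and a splice datum uniform in the blend parameter -/

section Blends

variable [FiniteDimensional ℝ E] {f : E → E}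

omit [FiniteDimensional ℝ E] in
/-- Derivative of the blend: `D(θ_s)(x) = (1 - s) I + s Df(x)`. [folklore] -/
theorem hasFDerivAt_blend (hf : ContDiff ℝ ∞ f) (s : ℝ) (x : E) :
    HasFDerivAt (blend f s)
      ((1 - s) • ContinuousLinearMap.id ℝ E + s • fderiv ℝ f x) x := by
  have hf' : HasFDerivAt f (fderiv ℝ f x) x := (hf.differentiable (by simp) x).hasFDerivAt
  have h := (hasFDerivAt_id x).add ((hf'.sub (hasFDerivAt_id x)).const_smul s)
  have heq : ContinuousLinearMap.id ℝ E + s • (fderiv ℝ f x - ContinuousLinearMap.id ℝ E) =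
      (1 - s) • ContinuousLinearMap.id ℝ E + s • fderiv ℝ f x := by
    ext w
    simp only [add_apply, ContinuousLinearMap.id_apply, smul_apply, sub_apply]
    module
  rw [← heq]
  exact h

omit [FiniteDimensional ℝ E] in
/-- `fderiv_blend` (fderiv blend). [folklore] -/
theorem fderiv_blend (hf : ContDiff ℝ ∞ f) (s : ℝ) (x : E) :
    fderiv ℝ (blend f s) x = (1 - s) • ContinuousLinearMap.id ℝ E + s • fderiv ℝ f x :=
  (hasFDerivAt_blend hf s x).fderiv

/-- An injective continuous linear endomorphism of a finite-dimensional space is invertible.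
[folklore] -/
theorem isInvertible_of_injective (M : E →L[ℝ] E) (hM : Injective M) : M.IsInvertible := by
  refine ⟨(LinearMap.linearEquivOfInjective (M : E →ₗ[ℝ] E) hM rfl).toContinuousLinearEquiv, ?_⟩
  ext w
  rfl

/-- **Splice datum** of a germ `f` fixing the sphere: the constants `ε₃, c, C₁, L` of the tree's
`SpliceHyp`, chosen so that they serve every blend `θ_s`, `s ∈ [0, 1]`, on the shell of width
`ε₃ / 2` with inner width `ε₃ / 4`. [folklore] -/
structure SpliceDatum (ε : ℝ) (f : E → E) (ε₃ c C₁ L : ℝ) : Prop where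
  ε₃_pos : 0 < ε₃
  ε₃_lt : ε₃ < ε
  c_pos : 0 < c
  C₁_pos : 0 < C₁
  lower : ∀ t ∈ Icc (0 : ℝ) 1, ∀ x ∈ (closedShell ε₃ : Set E), ∀ y ∈ (closedShell ε₃ : Set E),
    c * ‖x - y‖ ≤ ‖(x + t • (f x - x)) - (y + t • (f y - y))‖
  radial : ∀ x ∈ (closedShell ε₃ : Set E), ‖f x - x‖ ≤ C₁ * (1 - ‖x‖)
  L_pos : 0 < L
  exp_lt : (1 + C₁) * exp (-L) < ε₃ / 4
  quot_le : smoothTransitionDerivBound * C₁ / L ≤ c / 2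

/-- The splice datum exists. [folklore] -/
theorem exists_spliceDatum {ε : ℝ} {g : E → E} (h : IsInnerCollar ε f g) :
    ∃ ε₃ c C₁ L : ℝ, SpliceDatum ε f ε₃ c C₁ L := by
  obtain ⟨ε₃, c, hε₃, hε₃1, hc, hlow⟩ := h.exists_lower_bound_blend
  obtain ⟨C₁, hC₁, hrad⟩ := h.exists_norm_sub_self_le hε₃1
  have hq : (0 : ℝ) < ε₃ / 4 := by positivity
  have ev1 : ∀ᶠ L : ℝ in atTop, (1 + C₁) * exp (-L) < ε₃ / 4 := by
    have : Tendsto (fun L : ℝ => (1 + C₁) * exp (-L)) atTop (𝓝 ((1 + C₁) * 0)) :=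
      tendsto_exp_neg_atTop_nhds_zero.const_mul _
    rw [mul_zero] at this
    exact this.eventually (eventually_lt_nhds hq)
  have ev2 : ∀ᶠ L : ℝ in atTop, smoothTransitionDerivBound * C₁ / L ≤ c / 2 := by
    have : Tendsto (fun L : ℝ => smoothTransitionDerivBound * C₁ / L) atTop (𝓝 0) :=
      tendsto_const_nhds.div_atTop tendsto_id
    exact (this.eventually (eventually_lt_nhds (by positivity : (0 : ℝ) < c / 2))).mono
      fun L hL => le_of_lt hL
  obtain ⟨L, ⟨hL1, hL2⟩, hL0⟩ := ((ev1.and ev2).and (eventually_gt_atTop 0)).exists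
  exact ⟨ε₃, c, C₁, L, ⟨hε₃, hε₃1, hc, hC₁, hlow, hrad, hL0, hL1, hL2⟩⟩

variable {ε ε₃ c C₁ L : ℝ}

omit [FiniteDimensional ℝ E] in
/-- Norm of a blend point: `‖θ_s x‖ ≤ (1 - s) ‖x‖ + s ‖f x‖` for `s ∈ [0, 1]`. [folklore] -/
theorem norm_blend_le {s : ℝ} (hs : s ∈ Icc (0 : ℝ) 1) (x : E) :
    ‖blend f s x‖ ≤ (1 - s) * ‖x‖ + s * ‖f x‖ := by
  have h : blend f s x = (1 - s) • x + s • f x := by rw [blend_apply]; module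
  rw [h]
  calc ‖(1 - s) • x + s • f x‖ ≤ ‖(1 - s) • x‖ + ‖s • f x‖ := norm_add_le _ _
    _ = (1 - s) * ‖x‖ + s * ‖f x‖ := by
        rw [norm_smul, norm_smul, Real.norm_of_nonneg (by linarith [hs.2]),
          Real.norm_of_nonneg hs.1]

/-- **Every blend of the germ is an embedding germ along the closed shell**
`{1 - ε₃/2 ≤ ‖x‖ ≤ 1}`. [folklore] -/
theorem isEmbGerm_blend {g : E → E} (h : IsInnerCollar ε f g) (hd : SpliceDatum ε f ε₃ c C₁ L)
    (hf : ContDiff ℝ ∞ f) {s : ℝ} (hs : s ∈ Icc (0 : ℝ) 1) :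
    IsEmbGerm (closedBall (0 : E) 1 ∩ {x | 1 - ε₃ / 2 ≤ ‖x‖}) (blend f s) := by
  have hK3 : closedBall (0 : E) 1 ∩ {x | 1 - ε₃ / 2 ≤ ‖x‖} ⊆ closedShell ε₃ := fun x hx =>
    mem_closedShell_iff.2 ⟨by linarith [hx.2.out, hd.ε₃_pos], mem_closedBall_zero_iff.1 hx.1⟩
  refine ⟨contDiff_blend hf s, fun x hx => ?_, fun x hx y hy hxy => ?_⟩
  · rw [fderiv_blend hf]
    apply isInvertible_of_injective
    rcases (mem_closedBall_zero_iff.1 hx.1).lt_or_eq with hlt | heq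
    · -- interior point of the shell: uniform lower bound
      have hxo : x ∈ (openShell ε₃ : Set E) :=
        mem_openShell_iff.2 ⟨by linarith [hx.2.out, hd.ε₃_pos], hlt⟩
      have hlow := h.lower_bound_convexCombination hd.ε₃_lt.le hd.lower hs hxo
      rw [IsInnerCollar.fderivWithin_closedShell_eq hf (openShell_subset_closedShell (openShell_mono hd.ε₃_lt.le hxo))]
        at hlow
      refine (injective_iff_map_eq_zero _).2 fun w hw => ?_
      have h1 := hlow w
      rw [hw, norm_zero] at h1
      have : ‖w‖ ≤ 0 := by
        have := hd.c_pos; nlinarith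
      exact norm_le_zero_iff.1 this
    · have hinj := h.injective_convexCombination heq hs
      rwa [IsInnerCollar.fderivWithin_closedShell_eq hf (mem_closedShell_of_norm_eq_one h.pos heq)] at hinj
  · have hle := hd.lower s hs x (hK3 hx) y (hK3 hy)
    rw [show x + s • (f x - x) = blend f s x from rfl, show y + s • (f y - y) = blend f s y from rfl,
      hxy, sub_self, norm_zero] at hle
    have : ‖x - y‖ ≤ 0 := by have := hd.c_pos; nlinarith [norm_nonneg (x - y)]
    exact sub_eq_zero.1 (norm_le_zero_iff.1 this)

/-- **Every blend is an inner collar of width `ε₃ / 2`.** [folklore] -/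
theorem exists_isInnerCollar_blend {g : E → E} (h : IsInnerCollar ε f g)
    (hd : SpliceDatum ε f ε₃ c C₁ L) (hf : ContDiff ℝ ∞ f) {s : ℝ} (hs : s ∈ Icc (0 : ℝ) 1) :
    ∃ gs : E → E, IsInnerCollar (ε₃ / 2) (blend f s) gs := by
  have hK : IsCompact (closedBall (0 : E) 1 ∩ {x | 1 - ε₃ / 2 ≤ ‖x‖}) :=
    (isCompact_closedBall 0 1).inter_right (isClosed_le continuous_const continuous_norm)
  obtain ⟨gs, hgs, hleft, -, -⟩ := (isEmbGerm_blend h hd hf hs).exists_inverse hK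
  have hsub : (closedShell (ε₃ / 2) : Set E) ⊆ closedBall (0 : E) 1 ∩ {x | 1 - ε₃ / 2 ≤ ‖x‖} :=
    fun x hx => ⟨closedShell_subset_closedBall hx, (mem_closedShell_iff.1 hx).1.le⟩
  have hsubε : (closedShell (ε₃ / 2) : Set E) ⊆ closedShell ε :=
    closedShell_mono (by linarith [hd.ε₃_lt, hd.ε₃_pos])
  refine ⟨gs, { pos := by linarith [hd.ε₃_pos]
                contDiffOn := (contDiff_blend hf s).contDiffOn
                contDiffOn_symm := hgs.contDiffOn
                eq_self := fun x hx => by rw [blend_apply, h.eq_self x hx, sub_self, smul_zero, add_zero]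
                norm_le_one := fun x hx => ?_
                norm_lt_one := fun x hx hx1 => ?_
                left_inv := fun x hx _ => ?_ }⟩
  · have h1 : ‖x‖ ≤ 1 := (mem_closedShell_iff.1 hx).2
    have h2 : ‖f x‖ ≤ 1 := h.norm_le_one x (hsubε hx)
    calc ‖blend f s x‖ ≤ (1 - s) * ‖x‖ + s * ‖f x‖ := norm_blend_le hs x
      _ ≤ (1 - s) * 1 + s * 1 := by gcongr <;> linarith [hs.1, hs.2]
      _ = 1 := by ring
  · have h2 : ‖f x‖ < 1 := h.norm_lt_one x (hsubε hx) hx1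
    calc ‖blend f s x‖ ≤ (1 - s) * ‖x‖ + s * ‖f x‖ := norm_blend_le hs x
      _ < 1 := by
        rcases eq_or_lt_of_le hs.1 with h0 | h0
        · rw [← h0]; simpa using hx1
        · have : (1 - s) * ‖x‖ ≤ (1 - s) * 1 := by gcongr; linarith [hs.2]
          nlinarith
  · exact (hleft.filter_mono (nhds_le_nhdsSet (hsub hx))).self_of_nhds

omit [FiniteDimensional ℝ E] in
/-- **The splice hypotheses hold for every blend**, with the constants of the datum.
[folklore] -/
theorem spliceHyp_blend (hd : SpliceDatum ε f ε₃ c C₁ L) {s : ℝ} (hs : s ∈ Icc (0 : ℝ) 1) :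
    IsInnerCollar.SpliceHyp (ε₃ / 2) (blend f s) (ε₃ / 4) c C₁ L where
  ε₃_pos := by linarith [hd.ε₃_pos]
  ε₃_lt := by linarith [hd.ε₃_pos]
  c_pos := hd.c_pos
  C₁_pos := hd.C₁_pos
  lower t ht x hx y hy := by
    have hsub : (closedShell (ε₃ / 4) : Set E) ⊆ closedShell ε₃ :=
      closedShell_mono (by linarith [hd.ε₃_pos])
    rw [blend_blend, blend_blend]
    have hts : t * s ∈ Icc (0 : ℝ) 1 :=
      ⟨mul_nonneg ht.1 hs.1, by nlinarith [ht.1, ht.2, hs.1, hs.2]⟩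
    exact hd.lower (t * s) hts x (hsub hx) y (hsub hy)
  radial x hx := by
    have hsub : (closedShell (ε₃ / 4) : Set E) ⊆ closedShell ε₃ :=
      closedShell_mono (by linarith [hd.ε₃_pos])
    rw [blend_sub_self, norm_smul, Real.norm_of_nonneg hs.1]
    calc s * ‖f x - x‖ ≤ 1 * ‖f x - x‖ := by gcongr; exact hs.2
      _ = ‖f x - x‖ := one_mul _
      _ ≤ C₁ * (1 - ‖x‖) := hd.radial x (hsub hx)
  L_pos := hd.L_pos
  exp_lt := hd.exp_lt
  quot_le := hd.quot_le

end Blends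


/-! ### The stages of the splice family are embedding germs of the ball onto itself -/

section Stages

variable [FiniteDimensional ℝ E] {f g : E → E} {ε ε₃ c C₁ L : ℝ}

/-- `σ(v) ∈ [0, 1]`. [folklore] -/
theorem smoothTransition_mem_Icc (v : ℝ) : smoothTransition v ∈ Icc (0 : ℝ) 1 :=
  ⟨smoothTransition.nonneg v, smoothTransition.le_one v⟩

/-- **The derivative of a stage is invertible on the closed ball.** [folklore] -/
theorem isInvertible_fderiv_spliceFamily (h : IsInnerCollar ε f g) (hd : SpliceDatum ε f ε₃ c C₁ L)
    (hf : ContDiff ℝ ∞ f) (v : ℝ) {x : E} (hx : ‖x‖ ≤ 1) :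
    (fderiv ℝ (spliceFamily f L v) x).IsInvertible := by
  have hs := smoothTransition_mem_Icc v
  rcases hx.lt_or_eq with hlt | heq
  · -- interior: the stage is the tree's splice of the blend near `x`
    obtain ⟨gs, hgs⟩ := exists_isInnerCollar_blend h hd hf hs
    obtain ⟨D, hD⟩ := (spliceHyp_blend hd hs).exists_hasStrictFDerivAt hgs hlt
    have hev : spliceFamily f L v =ᶠ[𝓝 x] IsInnerCollar.splice (blend f (smoothTransition v)) L := by
      filter_upwards [(isOpen_lt continuous_norm continuous_const).mem_nhds hlt] with y hy
      exact spliceFamily_eq_splice hd.L_pos f v hy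
    refine ⟨D, ?_⟩
    rw [(hD.hasFDerivAt.congr_of_eventuallyEq hev).fderiv]
  · -- sphere point: the stage is the blend near `x`
    have hlt : 1 - exp (-2 * L) < ‖x‖ := by rw [heq]; linarith [exp_pos (-2 * L)]
    have hev : spliceFamily f L v =ᶠ[𝓝 x] blend f (smoothTransition v) := by
      filter_upwards [(isOpen_lt continuous_const continuous_norm).mem_nhds hlt] with y hy
      exact spliceFamily_eq_blend f v hy.le
    rw [hev.fderiv_eq, fderiv_blend hf]
    apply isInvertible_of_injective
    have hinj := h.injective_convexCombination heq hs
    rwa [IsInnerCollar.fderivWithin_closedShell_eq hf (mem_closedShell_of_norm_eq_one h.pos heq)] at hinj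

/-- A stage maps the open ball into itself. [folklore] -/
theorem norm_spliceFamily_lt_one (h : IsInnerCollar ε f g) (hd : SpliceDatum ε f ε₃ c C₁ L)
    (hf : ContDiff ℝ ∞ f) (v : ℝ) {x : E} (hx : ‖x‖ < 1) :
    ‖spliceFamily f L v x‖ < 1 := by
  have hs := smoothTransition_mem_Icc v
  obtain ⟨gs, hgs⟩ := exists_isInnerCollar_blend h hd hf hs
  rw [spliceFamily_eq_splice hd.L_pos f v hx]
  exact mem_ball_zero_iff.1 ((spliceHyp_blend hd hs).mapsTo_splice hgs (mem_ball_zero_iff.2 hx))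

/-- **A stage is injective on the closed ball.** [folklore] -/
theorem injOn_spliceFamily (h : IsInnerCollar ε f g) (hd : SpliceDatum ε f ε₃ c C₁ L)
    (hf : ContDiff ℝ ∞ f) (v : ℝ) :
    InjOn (spliceFamily f L v) (closedBall (0 : E) 1) := by
  have hs := smoothTransition_mem_Icc v
  have hinj := (spliceHyp_blend hd hs).injOn_splice
  intro x hx y hy hxy
  rcases (mem_closedBall_zero_iff.1 hx).lt_or_eq with hx1 | hx1 <;>
    rcases (mem_closedBall_zero_iff.1 hy).lt_or_eq with hy1 | hy1
  · rw [spliceFamily_eq_splice hd.L_pos f v hx1, spliceFamily_eq_splice hd.L_pos f v hy1] at hxy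
    exact hinj (mem_ball_zero_iff.2 hx1) (mem_ball_zero_iff.2 hy1) hxy
  · exfalso
    rw [spliceFamily_of_fixed L v (h.eq_self y hy1)] at hxy
    have := norm_spliceFamily_lt_one h hd hf v hx1
    rw [hxy, hy1] at this
    exact lt_irrefl _ this
  · exfalso
    rw [spliceFamily_of_fixed L v (h.eq_self x hx1)] at hxy
    have := norm_spliceFamily_lt_one h hd hf v hy1
    rw [← hxy, hx1] at this
    exact lt_irrefl _ this
  · rw [spliceFamily_of_fixed L v (h.eq_self x hx1), spliceFamily_of_fixed L v (h.eq_self y hy1)] at hxy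
    exact hxy

/-- **A stage maps the closed ball onto itself.** [folklore] -/
theorem image_spliceFamily (h : IsInnerCollar ε f g) (hd : SpliceDatum ε f ε₃ c C₁ L)
    (hf : ContDiff ℝ ∞ f) (v : ℝ) :
    spliceFamily f L v '' closedBall (0 : E) 1 = closedBall 0 1 := by
  have hs := smoothTransition_mem_Icc v
  obtain ⟨gs, hgs⟩ := exists_isInnerCollar_blend h hd hf hs
  have hsurj := (spliceHyp_blend hd hs).surjOn_splice hgs
  apply Subset.antisymm
  · rintro _ ⟨x, hx, rfl⟩
    rcases (mem_closedBall_zero_iff.1 hx).lt_or_eq with hx1 | hx1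
    · exact mem_closedBall_zero_iff.2 (norm_spliceFamily_lt_one h hd hf v hx1).le
    · rw [spliceFamily_of_fixed L v (h.eq_self x hx1)]; exact hx
  · intro y hy
    rcases (mem_closedBall_zero_iff.1 hy).lt_or_eq with hy1 | hy1
    · obtain ⟨x, hx, hxy⟩ := hsurj (mem_ball_zero_iff.2 hy1)
      refine ⟨x, ball_subset_closedBall hx, ?_⟩
      rw [spliceFamily_eq_splice hd.L_pos f v (mem_ball_zero_iff.1 hx), hxy]
    · exact ⟨y, hy, spliceFamily_of_fixed L v (h.eq_self y hy1)⟩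

/-- **The splice family of an inner collar is a self-isotopy of the closed unit ball** from the
identity. [cite: HirschDT1976, Ch. 8, Thm. 1.8 and remark] -/
theorem isSelfIsotopy_spliceFamily (h : IsInnerCollar ε f g) (hd : SpliceDatum ε f ε₃ c C₁ L)
    (hf : ContDiff ℝ ∞ f) :
    IsSelfIsotopy (closedBall (0 : E) 1) (spliceFamily f L) where
  contDiff := contDiff_spliceFamily hd.L_pos hf
  isEmbGerm v _ := ⟨contDiff_spliceFamily_stage hd.L_pos hf v,
    fun x hx => isInvertible_fderiv_spliceFamily h hd hf v (mem_closedBall_zero_iff.1 hx),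
    injOn_spliceFamily h hd hf v⟩
  image_eq v _ := image_spliceFamily h hd hf v
  zero_apply x _ := by rw [spliceFamily_zero]; rfl

omit [FiniteDimensional ℝ E] in
/-- The end of the splice family is the collar map on `{1 - e^{-2L} ≤ ‖x‖}`. [folklore] -/
theorem spliceFamily_one_eq (f : E → E) {x : E} (hx : 1 - exp (-2 * L) ≤ ‖x‖) :
    spliceFamily f L 1 x = f x := by
  rw [spliceFamily_eq_blend f 1 hx, smoothTransition.one, blend_one]

/-- **Realising an inner collar by a self-isotopy of the ball.**  For an inner collar `f` of the
unit sphere (a smooth map, `C^∞`-invertible on a shell, fixing the sphere pointwise) there is a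
self-isotopy `D` of the closed unit ball from the identity whose end agrees with `f` on a collar
`{1 - δ ≤ ‖x‖}`; all stages fix the fixed points of `f`.
[cite: HirschDT1976, Ch. 8, Thm. 1.8 and the remark following it] -/
theorem exists_selfIsotopy_of_innerCollar (hf : ContDiff ℝ ∞ f) (h : IsInnerCollar ε f g) :
    ∃ D : ℝ → E → E, IsSelfIsotopy (closedBall (0 : E) 1) D ∧
      (∃ δ : ℝ, 0 < δ ∧ ∀ x : E, 1 - δ ≤ ‖x‖ → D 1 x = f x) ∧
      (∀ v x, f x = x → D v x = x) ∧ (∀ x, D 0 x = x) ∧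
      ∀ v x, ∃ s ∈ Icc (0 : ℝ) 1, D v x = x + s • (f x - x) := by
  obtain ⟨ε₃, c, C₁, L, hd⟩ := exists_spliceDatum h
  refine ⟨spliceFamily f L, isSelfIsotopy_spliceFamily h hd hf, ⟨exp (-2 * L), exp_pos _,
    fun x hx => spliceFamily_one_eq f hx⟩, fun v x hx => spliceFamily_of_fixed L v hx,
    fun x => by rw [spliceFamily_zero]; rfl, fun v x => ?_⟩
  refine ⟨smoothTransition v * omegaCut L (1 - ‖x‖), ⟨mul_nonneg (smoothTransition.nonneg v)
    (omegaCut_mem_Icc L _).1, mul_le_one₀ (smoothTransition.le_one v) (omegaCut_mem_Icc L _).1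
    (omegaCut_mem_Icc L _).2⟩, rfl⟩

end Stages

/-! ### Collar normalisation -/

section Main

variable [FiniteDimensional ℝ E] {f : E → E}

/-- **Collar normalisation.**  An embedding germ `f` of the closed unit ball onto itself fixing
the unit sphere pointwise is related by a self-isotopy of the ball (`IsoRel`) to an embedding
germ `f₂` of the ball onto itself which is THE IDENTITY on a collar `{1 - δ < ‖x‖ ≤ 1}` of the
sphere: `f₂ = f ∘ D₁⁻¹` for the splice family `D`.
[cite: HirschDT1976, Ch. 8, Thm. 1.8 and the remark following it] -/
theorem exists_isoRel_eq_id_near_sphere (hf : IsEmbGerm (closedBall (0 : E) 1) f)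
    (himg : f '' closedBall (0 : E) 1 = closedBall 0 1) (hfix : ∀ x : E, ‖x‖ = 1 → f x = x) :
    ∃ f₂ : E → E, IsoRel (closedBall (0 : E) 1) f f₂ ∧ IsEmbGerm (closedBall (0 : E) 1) f₂ ∧
      f₂ '' closedBall (0 : E) 1 = closedBall 0 1 ∧
      ∃ δ : ℝ, 0 < δ ∧ ∀ x ∈ closedBall (0 : E) 1, 1 - δ < ‖x‖ → f₂ x = x := by
  obtain ⟨g, h⟩ := exists_isInnerCollar hf himg hfix
  obtain ⟨ε₃, c, C₁, L, hd⟩ := exists_spliceDatum h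
  have hD := isSelfIsotopy_spliceFamily h hd hf.contDiff
  obtain ⟨G, hG, hGD, hDG⟩ := hD.exists_inverse (isCompact_closedBall 0 1)
  have h1 : (1 : ℝ) ∈ Icc (0 : ℝ) 1 := ⟨zero_le_one, le_rfl⟩
  have hG1 : IsEmbGerm (closedBall (0 : E) 1) (G 1) := hG.isEmbGerm 1 h1
  have hG1img : G 1 '' closedBall (0 : E) 1 = closedBall 0 1 := hG.image_eq 1 h1
  refine ⟨f ∘ G 1, ⟨G, hG, fun x _ => rfl⟩, (hG1img.symm ▸ hf).comp hG1, ?_, ?_⟩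
  · rw [image_comp, hG1img, himg]
  · -- the compact set of points of the ball sent deep inside by `G₁`
    set S : Set E := closedBall (0 : E) 1 ∩ {x | ‖G 1 x‖ ≤ 1 - exp (-2 * L)} with hS
    have hGc : Continuous (G 1) := (hG.contDiff_stage 1).continuous
    have hSc : IsCompact S :=
      (isCompact_closedBall 0 1).inter_right (isClosed_le (continuous_norm.comp hGc) continuous_const)
    -- on `S` the norm is `< 1`
    have hSlt : ∀ x ∈ S, ‖x‖ < 1 := by
      intro x hx
      rcases (mem_closedBall_zero_iff.1 hx.1).lt_or_eq with hlt | heq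
      · exact hlt
      · exfalso
        have hfx : spliceFamily f L 1 x = x := spliceFamily_of_fixed L 1 (hfix x heq)
        have hGx : G 1 x = x := by
          have := hGD 1 h1 x hx.1
          rwa [hfx] at this
        have h2 : ‖G 1 x‖ ≤ 1 - exp (-2 * L) := hx.2
        rw [hGx, heq] at h2
        linarith [exp_pos (-2 * L)]
    -- `δ` from the maximum of the norm on `S` (or `1` if `S` is empty)
    obtain ⟨δ, hδ, hδS⟩ : ∃ δ : ℝ, 0 < δ ∧ ∀ x ∈ S, ‖x‖ ≤ 1 - δ := by
      rcases S.eq_empty_or_nonempty with hSe | hSne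
      · exact ⟨1, one_pos, fun x hx => by rw [hSe] at hx; exact hx.elim⟩
      · obtain ⟨x₀, hx₀, hmax⟩ := hSc.exists_isMaxOn hSne continuous_norm.continuousOn
        refine ⟨1 - ‖x₀‖, by linarith [hSlt x₀ hx₀], fun x hx => ?_⟩
        have : ‖x‖ ≤ ‖x₀‖ := hmax hx
        linarith
    refine ⟨δ, hδ, fun x hx hxδ => ?_⟩
    have hxS : x ∉ S := fun hxS => by linarith [hδS x hxS]
    have hGx : 1 - exp (-2 * L) < ‖G 1 x‖ := by
      by_contra hle
      exact hxS ⟨hx, not_lt.1 hle⟩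
    -- `D₁ (G₁ x) = x` and `D₁ = blend f 1 = f` at `G₁ x`
    have hDGx := hDG 1 h1 x hx
    rw [spliceFamily_eq_blend f 1 hGx.le, smoothTransition.one, blend_one] at hDGx
    exact hDGx

end Main

end CollarNormalisation

end Literature.Topology.FourManifolds
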